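/-
Copyright (c) 2026 the pub-hodgecm-mathlib formalisation cell (harness21).  Prover seat hodgecm-mathlib-R90-CS-p03 (g2), R90-TF section S8 «ContSpec-n½» (dealer R90-CS-plan (g3),
S8-R159 order; file (a-10b), the corollary of ★ (a-10) `K2E1ChiArchNonvanishingAssemblyU3` over the ★ (a-6) cores `K2E1ChiArchBetaNonvanishingU3`): THE ARCHIMEDEAN FACTOR OF THE
χ-INTERTWINING AMPLITUDE AT `z = 3∕2` IS NON-ZERO FOR THE PHASE WEIGHTS OF RECORD `∏_w ε_w·(ζ_w∕|ζ_w|)^{n_w}`, `ζ_w = −(1+‖Ξ_w‖²∕2) + i·β_w·s_w`, `n_w ≤ 2` (J-S8-∞′, `t_w = 0`).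
-/
import Summits.HodgeConjecture.HodgeConjecture.Theorems.K2E1ChiArchNonvanishingAssemblyU3   -- ★ (a-10): HEAD `integral_integral_prodWeight_mul_arch_cpow_neg_ne_zero`
import Summits.HodgeConjecture.HodgeConjecture.Theorems.K2E1ChiArchBetaNonvanishingU3       -- ★ (a-6): the one-variable cores at `z = 3∕2`
import HarnessLib

/-!
# K2·E1 ∕ R90·S8 — `K2E1ChiArchNonvanishingPhaseWeightsU3` (file (a-10b)): THE ARCHIMEDEAN HALF OF ★ F5's `hA32` FOR THE PHASE WEIGHTS OF RECORD —
# `∫_{L_∞}∫_{L⁺_∞} (∏_{w∣∞} ε_w·(ζ_w∕|ζ_w|)^{n_w})·ARCH₃(Ξ,a)^{−3∕2} dμ_{F,∞} dμ_{E,∞} ≠ 0`, `ζ_w = −(1+‖Ξ_w‖²∕2) + i·β_w·s_w(a)`, `β_w² = (wδ)²`, `0 < ‖ε_w‖ ≤ 1`, `n_w ∈ {0, 1, 2}`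

Cell `pub/hodgecm-mathlib`, crux h413 = `stmt-HodgeConjecture-24833`, route of record `HCCMUnconditional`; R90-TF section S8 «ContSpec-n½», road R2-χ₃ (the (V) scalar road; ★ F5's binder
`hA32 : A (3∕2) ≠ 0` for the ★ (a-2b)∕(a-3) amplitude).  THEOREMS ONLY (no `def`, no `instance`, no notation, no named-fact hypothesis, no `sorry`; default heartbeats); lane
`--supports stmt-HodgeConjecture-24833 --as helper` (count-neutral).  Closes no socket.

THE `(t_w, m_w)` TABLE OF RECORD (junction J-S8-∞′ ∕ S8-R157 ∕ S8-R159; ★ p863579 `K2E1ArchIwasawaKPartU21.uPhase_and_dictionary_signOfRecord`).  At every (complex) place `w` of the CM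
field `L` the `K_∞`-part of the big cell `Φ₃·u(X,Z) = b·k` carries, for the 1-dim `K_∞`-type `det^{a_w} ⊗ u^{c_w}` (`a_w = m₂`, `c_w = m₁ − 2m₂` on `T ∩ K_∞`), the weight
`det(k)^{a_w}·u(k)^{c_w} = (−1)^{a_w}·((Z_w − 1)∕|1 − Z_w|)^{c_w}` — ONE phase, that of `Z_w − 1 = −(1 + ‖X_w‖²∕2) + i·Im Z_w` (`Re Z_w = −‖X_w‖²∕2` by the Heisenberg relation, ★
`norm_sq_one_sub_eq_arch`), NO `X_w`-phase; for the algebraic Hecke characters of record `t_w = 0` (no `|1 − Z_w|^{−it_w}`).  In the letters of ★ (a2)₃ ∕ (a-3): `Im Z_w = β_w·s_w(a)` with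
`β_w = ±(wδ)` (the sign of the chosen embedding), `A_w = 1 + ‖Ξ_w‖²∕2`, `|1 − Z_w|² = A_w² + (wδ)²s_w² = ` the `w`-factor of `ARCH₃`.  So the weight of record IS of the product form of ★ (a-10) with
`θ_w(r, s) = ε_w·(ζ_w(r,s)∕|ζ_w(r,s)|)^{n_w}`, `ζ_w(r,s) = −(1 + r²∕2) + i·β_w·s`, `ε_w = (−1)^{a_w}` (any `0 < ‖ε_w‖ ≤ 1` here), `n_w = |c_w|` (a negative `c_w` is the conjugate phase:
replace `β_w` by `−β_w`, allowed since only `β_w² = (wδ)²` is used).  DICHOTOMY at `z = 3∕2`, `t_w = 0` (S8-R157): the place factor `∫_ℝ (ζ∕|ζ|)^{n}·|ζ|^{−3} ds` is `≠ 0` iff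
`n ∉ 2ℕ + 3`; THIS FILE covers `n_w ∈ {0, 1, 2}` (★ (a-6) cores: `m = 0`: `∫ q^{−3∕2} > 0`; `m = ±1`: `Re = ∓A·∫q^{−2}`; `m = ±2`: `Re = B²·∫ s² q^{−5∕2} > 0` by the fundamental theorem of
calculus).  NOT covered (HONEST SCOPE): `n_w` odd `≥ 3` (the factor VANISHES — the line must then use `t_w ≠ 0` or another `K_∞`-type), `n_w` even `≥ 4` (non-zero, a Beta-function
evaluation not typed tonight), `t_w ≠ 0` (complex exponents), and the IDENTIFICATION «p11's `archSectionL` on the big cell, place by place, `= θ_w(‖Ξ_w‖, s_w a)`» (K2E1-p13 ∕ K2E1-p11,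
over ★ p863579 and ★ `K2E1HeightBigCellLineFormulaU2`).

THE MATHEMATICS ([MoeglinWaldspurger1995] IV.1.11; [Langlands1976] Appendix; [Titchmarsh1939] §1.8).  With `q = A² + B²s²` (`A = 1 + r²∕2 > 0`, `B = wδ ≠ 0`, `β² = B²`) and
`ζ = −A + iβs`, `|ζ| = √q`, so `(ζ∕|ζ|)^n·q^{−3∕2} = ζ^n·q^{−(3+n)∕2}`; rotating by `κ = \bar ε` (`n = 0, 2`) or `κ = −\bar ε` (`n = 1`):
`Re(κ·ε·∫ζ^0 q^{−3∕2}) = ‖ε‖²·∫q^{−3∕2} > 0`, `Re(−\bar ε·ε·∫ ζ q^{−2}) = ‖ε‖²·A·∫q^{−2} > 0`, `Re(\bar ε·ε·∫ ζ² q^{−5∕2}) = ‖ε‖²·∫(A² − β²s²)q^{−5∕2} = ‖ε‖²·B²·∫ s² q^{−5∕2} > 0` (★ (a-6)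
`integral_re_phaseTwo_eq`).  ★ (a-10)'s HEAD then gives the non-vanishing of the iterated archimedean integral.
* §1 the phase letter `ζ(r,s) = −(1+r²∕2) + iβs`: norm, positivity of the norm, `‖ε(ζ∕|ζ|)^n‖ ≤ 1`, continuity; `((q:ℝ):ℂ)^{−(3∕2:ℝ)} = ((q^{−3∕2} : ℝ) : ℂ)`.
* §2 the three rotated positivities `re_rotated_integral_phase{Zero,One,Two}_pos` (per place, all `r`).
* §3 HEAD **`integral_integral_phaseWeights_mul_arch_cpow_neg_threeHalves_ne_zero`** — ★ (a-10) applied at `σ = 3∕2`, exponent printed `-(3 / 2 : ℂ)`.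
HONEST LABEL: HC_CM is proved only modulo the 7 printed citations (2 remaining named inputs: hLiu418 = `stmt-HodgeConjecture-24832`, h413 = `stmt-HodgeConjecture-24833`) until rung 0
closes; REL ≠ ★ ≠ BUILT; this file asserts no named fact and closes no socket; count-neutral; unconditional analysis.

## References
* [MoeglinWaldspurger1995] C. Mœglin, J.-L. Waldspurger, *Spectral Decomposition and Eisenstein Series* (1995): II.1.7, IV.1.11.
* [Langlands1976] R. P. Langlands, *On the Functional Equations Satisfied by Eisenstein Series*, LNM 544 (1976): Appendix (rank one).
* [Titchmarsh1939] E. C. Titchmarsh, *The Theory of Functions*, 2nd ed. (1939): §1.8.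
-/

set_option autoImplicit false
set_option linter.dupNamespace false -- the mandated namespace repeats `HodgeConjecture.HodgeConjecture`

noncomputable section

open MeasureTheory MeasureTheory.Measure NumberField NumberField.InfinitePlace Filter Set
open scoped Topology ComplexConjugate
open Summit.HodgeConjecture.HodgeConjecture.Cruxes.H413
open Summit.HodgeConjecture.HodgeConjecture.Cruxes.H413.K2E1ChiArchBetaNonvanishingU3 (base_pos integrable_base_rpow_neg integral_base_rpow_neg_pos integral_base_rpow_neg_threeHalves_pos
  integral_re_phaseTwo_eq integral_sq_mul_base_rpow_neg_fiveHalves_pos)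
open Summit.HodgeConjecture.HodgeConjecture.Cruxes.H413.K2E1ChiArchNonvanishingAssemblyU3 (integral_integral_prodWeight_mul_arch_cpow_neg_ne_zero)

namespace Summit.HodgeConjecture.HodgeConjecture.Cruxes.H413.K2E1ChiArchNonvanishingPhaseWeightsU3

/-! ## §1 The phase letter `ζ(r,s) = −(1 + r²∕2) + i·β·s` -/

/-- `|ζ(r,s)| = √((1 + r²∕2)² + β²s²)` (Mathlib `Complex.norm_add_mul_I`). [folklore] -/
theorem norm_phaseLetter (r β s : ℝ) :
    ‖(((-(1 + r ^ 2 / 2)) : ℝ) : ℂ) + ((β * s : ℝ) : ℂ) * Complex.I‖ = Real.sqrt ((1 + r ^ 2 / 2) ^ 2 + β ^ 2 * s ^ 2) := by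
  rw [Complex.norm_add_mul_I, neg_sq, mul_pow]

/-- `|ζ(r,s)|² = (1 + r²∕2)² + β²s²`. [folklore] -/
theorem norm_phaseLetter_sq (r β s : ℝ) :
    ‖(((-(1 + r ^ 2 / 2)) : ℝ) : ℂ) + ((β * s : ℝ) : ℂ) * Complex.I‖ ^ 2 = (1 + r ^ 2 / 2) ^ 2 + β ^ 2 * s ^ 2 := by
  rw [norm_phaseLetter, Real.sq_sqrt (by positivity)]

/-- `|ζ(r,s)| > 0` (`Re ζ = −(1 + r²∕2) < 0`). [folklore] -/
theorem norm_phaseLetter_pos (r β s : ℝ) : 0 < ‖(((-(1 + r ^ 2 / 2)) : ℝ) : ℂ) + ((β * s : ℝ) : ℂ) * Complex.I‖ := by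
  rw [norm_phaseLetter]
  exact Real.sqrt_pos.2 (by positivity)

/-- **The phase weight has modulus `≤ 1`**: `‖ε·(ζ∕|ζ|)^n‖ = ‖ε‖ ≤ 1`. [folklore] -/
theorem norm_phaseWeight_le {ε : ℂ} (hε1 : ‖ε‖ ≤ 1) (n : ℕ) (r β s : ℝ) :
    ‖ε * (((((-(1 + r ^ 2 / 2)) : ℝ) : ℂ) + ((β * s : ℝ) : ℂ) * Complex.I) / ((‖(((-(1 + r ^ 2 / 2)) : ℝ) : ℂ) + ((β * s : ℝ) : ℂ) * Complex.I‖ : ℝ) : ℂ)) ^ n‖ ≤ 1 := by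
  rw [norm_mul, norm_pow, norm_div, Complex.norm_real, Real.norm_of_nonneg (norm_nonneg _), div_self (norm_phaseLetter_pos r β s).ne', one_pow, mul_one]
  exact hε1

/-- **The phase weight is jointly continuous in `(r, s)`** (`ζ` is polynomial, `|ζ| > 0`). [folklore] -/
theorem continuous_phaseWeight (ε : ℂ) (β : ℝ) (n : ℕ) :
    Continuous fun x : ℝ × ℝ => ε * (((((-(1 + x.1 ^ 2 / 2)) : ℝ) : ℂ) + ((β * x.2 : ℝ) : ℂ) * Complex.I) /
      ((‖(((-(1 + x.1 ^ 2 / 2)) : ℝ) : ℂ) + ((β * x.2 : ℝ) : ℂ) * Complex.I‖ : ℝ) : ℂ)) ^ n := by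
  have hζ : Continuous fun x : ℝ × ℝ => (((-(1 + x.1 ^ 2 / 2)) : ℝ) : ℂ) + ((β * x.2 : ℝ) : ℂ) * Complex.I :=
    (Complex.continuous_ofReal.comp (continuous_const.add ((continuous_fst.pow 2).div_const 2)).neg).add
      ((Complex.continuous_ofReal.comp (continuous_const.mul continuous_snd)).mul continuous_const)
  exact continuous_const.mul ((hζ.div (Complex.continuous_ofReal.comp hζ.norm) fun x => Complex.ofReal_ne_zero.2 (norm_phaseLetter_pos _ _ _).ne').pow n)

/-- `((q : ℝ) : ℂ)^{−((3∕2 : ℝ) : ℂ)} = ((q^{−3∕2} : ℝ) : ℂ)` for `q ≥ 0` (Mathlib `Complex.ofReal_cpow`). [folklore] -/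
theorem ofReal_cpow_neg_threeHalves {q : ℝ} (hq : 0 ≤ q) : ((q : ℝ) : ℂ) ^ (-((3 / 2 : ℝ) : ℂ)) = (((q ^ (-(3 / 2 : ℝ))) : ℝ) : ℂ) := by
  rw [Complex.ofReal_cpow hq, Complex.ofReal_neg]

/-! ## §2 The three rotated positivities at `z = 3∕2` (per place, every `r`) -/

section OnePlace

variable {B β : ℝ} (hB : B ≠ 0) (hβ : β ^ 2 = B ^ 2) {ε : ℂ} (hε : ε ≠ 0)

include hB hε in
/-- **`n = 0`**: `Re(\bar ε·∫ ε·(ζ∕|ζ|)^0·q^{−3∕2}) = ‖ε‖²·∫ q^{−3∕2} ds > 0` (★ (a-6) `integral_base_rpow_neg_threeHalves_pos`). [cite: MoeglinWaldspurger1995, IV.1.11] -/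
theorem re_rotated_integral_phaseZero_pos (β r : ℝ) :
    0 < (conj ε * ∫ s : ℝ, ε * (((((-(1 + r ^ 2 / 2)) : ℝ) : ℂ) + ((β * s : ℝ) : ℂ) * Complex.I) / ((‖(((-(1 + r ^ 2 / 2)) : ℝ) : ℂ) + ((β * s : ℝ) : ℂ) * Complex.I‖ : ℝ) : ℂ)) ^ 0 *
      ((((1 + r ^ 2 / 2) ^ 2 + B ^ 2 * s ^ 2 : ℝ) : ℂ) ^ (-((3 / 2 : ℝ) : ℂ)))).re := by
  have hA : (0 : ℝ) < 1 + r ^ 2 / 2 := by positivity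
  have hpt : ∀ s : ℝ, ε * (((((-(1 + r ^ 2 / 2)) : ℝ) : ℂ) + ((β * s : ℝ) : ℂ) * Complex.I) / ((‖(((-(1 + r ^ 2 / 2)) : ℝ) : ℂ) + ((β * s : ℝ) : ℂ) * Complex.I‖ : ℝ) : ℂ)) ^ 0 *
      ((((1 + r ^ 2 / 2) ^ 2 + B ^ 2 * s ^ 2 : ℝ) : ℂ) ^ (-((3 / 2 : ℝ) : ℂ))) = ε * (((((1 + r ^ 2 / 2) ^ 2 + B ^ 2 * s ^ 2) ^ (-(3 / 2 : ℝ))) : ℝ) : ℂ) := fun s => by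
    rw [pow_zero, mul_one, ofReal_cpow_neg_threeHalves (base_pos hA B s).le]
  simp_rw [hpt]
  rw [integral_const_mul, integral_complex_ofReal, ← mul_assoc, Complex.conj_mul', ← Complex.ofReal_pow, Complex.re_ofReal_mul, Complex.ofReal_re]
  exact mul_pos (pow_pos (norm_pos_iff.2 hε) 2) (integral_base_rpow_neg_threeHalves_pos hA hB)

include hB hβ hε in
/-- **`n = 1`**: `(ζ∕|ζ|)·q^{−3∕2} = ζ·q^{−2}` (`|ζ| = √q` by `β² = B²`), and `Re(−\bar ε·ε·∫ ζ q^{−2}) = ‖ε‖²·(1 + r²∕2)·∫ q^{−2} ds > 0` (★ (a-6) `integral_base_rpow_neg_pos`).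
[cite: MoeglinWaldspurger1995, IV.1.11] [cite: Langlands1976, Appendix] -/
theorem re_rotated_integral_phaseOne_pos (r : ℝ) :
    0 < (-conj ε * ∫ s : ℝ, ε * (((((-(1 + r ^ 2 / 2)) : ℝ) : ℂ) + ((β * s : ℝ) : ℂ) * Complex.I) / ((‖(((-(1 + r ^ 2 / 2)) : ℝ) : ℂ) + ((β * s : ℝ) : ℂ) * Complex.I‖ : ℝ) : ℂ)) ^ 1 *
      ((((1 + r ^ 2 / 2) ^ 2 + B ^ 2 * s ^ 2 : ℝ) : ℂ) ^ (-((3 / 2 : ℝ) : ℂ)))).re := by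
  have hA : (0 : ℝ) < 1 + r ^ 2 / 2 := by positivity
  -- pointwise: `ε·(ζ/|ζ|)·q^{−3/2} = ε·(ζ·q^{−2})`
  have hpt : ∀ s : ℝ, ε * (((((-(1 + r ^ 2 / 2)) : ℝ) : ℂ) + ((β * s : ℝ) : ℂ) * Complex.I) / ((‖(((-(1 + r ^ 2 / 2)) : ℝ) : ℂ) + ((β * s : ℝ) : ℂ) * Complex.I‖ : ℝ) : ℂ)) ^ 1 *
      ((((1 + r ^ 2 / 2) ^ 2 + B ^ 2 * s ^ 2 : ℝ) : ℂ) ^ (-((3 / 2 : ℝ) : ℂ))) =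
        ε * (((((-(1 + r ^ 2 / 2)) : ℝ) : ℂ) + ((β * s : ℝ) : ℂ) * Complex.I) * (((((1 + r ^ 2 / 2) ^ 2 + B ^ 2 * s ^ 2) ^ (-(2 : ℝ))) : ℝ) : ℂ)) := fun s => by
    have hq := base_pos hA B s
    rw [pow_one, norm_phaseLetter, hβ, ofReal_cpow_neg_threeHalves hq.le, mul_assoc]
    congr 1
    rw [div_mul_eq_mul_div, div_eq_iff (Complex.ofReal_ne_zero.2 (Real.sqrt_pos.2 hq).ne'), mul_assoc, ← Complex.ofReal_mul]
    congr 2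
    rw [Real.sqrt_eq_rpow, ← Real.rpow_add hq]
    norm_num
  simp_rw [hpt]
  -- the integrand `ζ·q^{−2}` is integrable (`|ζ|·q^{−2} = q^{−3/2}`)
  have hFint : Integrable fun s : ℝ => ((((-(1 + r ^ 2 / 2)) : ℝ) : ℂ) + ((β * s : ℝ) : ℂ) * Complex.I) * (((((1 + r ^ 2 / 2) ^ 2 + B ^ 2 * s ^ 2) ^ (-(2 : ℝ))) : ℝ) : ℂ) := by
    have hc : Continuous fun s : ℝ => ((((-(1 + r ^ 2 / 2)) : ℝ) : ℂ) + ((β * s : ℝ) : ℂ) * Complex.I) * (((((1 + r ^ 2 / 2) ^ 2 + B ^ 2 * s ^ 2) ^ (-(2 : ℝ))) : ℝ) : ℂ) :=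
      (continuous_const.add ((Complex.continuous_ofReal.comp (continuous_const.mul continuous_id)).mul continuous_const)).mul
        (Complex.continuous_ofReal.comp ((continuous_const.add (continuous_const.mul (continuous_id.pow 2))).rpow_const fun s => Or.inl (base_pos hA B s).ne'))
    refine (integrable_base_rpow_neg hA hB (a := 3 / 2) (by norm_num)).mono' hc.aestronglyMeasurable (Eventually.of_forall fun s => le_of_eq ?_)
    have hq := base_pos hA B s
    rw [norm_mul, norm_phaseLetter, hβ, Complex.norm_real, Real.norm_of_nonneg (Real.rpow_nonneg hq.le _), Real.sqrt_eq_rpow, ← Real.rpow_add hq]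
    norm_num
  -- its real part is `−(1 + r²/2)·∫ q^{−2}`
  have hre : (∫ s : ℝ, ((((-(1 + r ^ 2 / 2)) : ℝ) : ℂ) + ((β * s : ℝ) : ℂ) * Complex.I) * (((((1 + r ^ 2 / 2) ^ 2 + B ^ 2 * s ^ 2) ^ (-(2 : ℝ))) : ℝ) : ℂ)).re =
      -(1 + r ^ 2 / 2) * ∫ s : ℝ, ((1 + r ^ 2 / 2) ^ 2 + B ^ 2 * s ^ 2) ^ (-(2 : ℝ)) := by
    have h := integral_re hFint
    simp only [RCLike.re_to_complex] at h
    rw [← h, ← integral_const_mul]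
    refine integral_congr_ae (Eventually.of_forall fun s => ?_)
    simp only [Complex.mul_re, Complex.add_re, Complex.ofReal_re, Complex.mul_im, Complex.add_im, Complex.ofReal_im, Complex.I_re, Complex.I_im]
    ring
  rw [integral_const_mul, ← mul_assoc, neg_mul, Complex.conj_mul', ← Complex.ofReal_pow, neg_mul, Complex.neg_re, Complex.re_ofReal_mul, hre, neg_mul, mul_neg, neg_neg]
  exact mul_pos (pow_pos (norm_pos_iff.2 hε) 2) (mul_pos hA (integral_base_rpow_neg_pos hA hB (by norm_num)))

include hB hβ hε in
/-- **`n = 2`**: `(ζ∕|ζ|)²·q^{−3∕2} = ζ²·q^{−5∕2}` (`|ζ|² = q`), and `Re(\bar ε·ε·∫ ζ² q^{−5∕2}) = ‖ε‖²·∫ (A² − B²s²) q^{−5∕2} = ‖ε‖²·B²·∫ s² q^{−5∕2} > 0` (★ (a-6)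
`integral_re_phaseTwo_eq`, `integral_sq_mul_base_rpow_neg_fiveHalves_pos`). [cite: MoeglinWaldspurger1995, IV.1.11] [cite: Langlands1976, Appendix] -/
theorem re_rotated_integral_phaseTwo_pos (r : ℝ) :
    0 < (conj ε * ∫ s : ℝ, ε * (((((-(1 + r ^ 2 / 2)) : ℝ) : ℂ) + ((β * s : ℝ) : ℂ) * Complex.I) / ((‖(((-(1 + r ^ 2 / 2)) : ℝ) : ℂ) + ((β * s : ℝ) : ℂ) * Complex.I‖ : ℝ) : ℂ)) ^ 2 *
      ((((1 + r ^ 2 / 2) ^ 2 + B ^ 2 * s ^ 2 : ℝ) : ℂ) ^ (-((3 / 2 : ℝ) : ℂ)))).re := by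
  have hA : (0 : ℝ) < 1 + r ^ 2 / 2 := by positivity
  -- pointwise: `ε·(ζ/|ζ|)²·q^{−3/2} = ε·(ζ²·q^{−5/2})`
  have hpt : ∀ s : ℝ, ε * (((((-(1 + r ^ 2 / 2)) : ℝ) : ℂ) + ((β * s : ℝ) : ℂ) * Complex.I) / ((‖(((-(1 + r ^ 2 / 2)) : ℝ) : ℂ) + ((β * s : ℝ) : ℂ) * Complex.I‖ : ℝ) : ℂ)) ^ 2 *
      ((((1 + r ^ 2 / 2) ^ 2 + B ^ 2 * s ^ 2 : ℝ) : ℂ) ^ (-((3 / 2 : ℝ) : ℂ))) =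
        ε * (((((-(1 + r ^ 2 / 2)) : ℝ) : ℂ) + ((β * s : ℝ) : ℂ) * Complex.I) ^ 2 * (((((1 + r ^ 2 / 2) ^ 2 + B ^ 2 * s ^ 2) ^ (-(5 / 2 : ℝ))) : ℝ) : ℂ)) := fun s => by
    have hq := base_pos hA B s
    rw [div_pow, ← Complex.ofReal_pow, norm_phaseLetter_sq, hβ, ofReal_cpow_neg_threeHalves hq.le, mul_assoc]
    congr 1
    rw [div_mul_eq_mul_div, div_eq_iff (Complex.ofReal_ne_zero.2 hq.ne'), mul_assoc, ← Complex.ofReal_mul]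
    congr 2
    rw [← Real.rpow_add_one hq.ne']
    norm_num
  simp_rw [hpt]
  -- the integrand `ζ²·q^{−5/2}` is integrable (`|ζ|²·q^{−5/2} = q^{−3/2}`)
  have hFint : Integrable fun s : ℝ => ((((-(1 + r ^ 2 / 2)) : ℝ) : ℂ) + ((β * s : ℝ) : ℂ) * Complex.I) ^ 2 * (((((1 + r ^ 2 / 2) ^ 2 + B ^ 2 * s ^ 2) ^ (-(5 / 2 : ℝ))) : ℝ) : ℂ) := by
    have hc : Continuous fun s : ℝ => ((((-(1 + r ^ 2 / 2)) : ℝ) : ℂ) + ((β * s : ℝ) : ℂ) * Complex.I) ^ 2 * (((((1 + r ^ 2 / 2) ^ 2 + B ^ 2 * s ^ 2) ^ (-(5 / 2 : ℝ))) : ℝ) : ℂ) :=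
      ((continuous_const.add ((Complex.continuous_ofReal.comp (continuous_const.mul continuous_id)).mul continuous_const)).pow 2).mul
        (Complex.continuous_ofReal.comp ((continuous_const.add (continuous_const.mul (continuous_id.pow 2))).rpow_const fun s => Or.inl (base_pos hA B s).ne'))
    refine (integrable_base_rpow_neg hA hB (a := 3 / 2) (by norm_num)).mono' hc.aestronglyMeasurable (Eventually.of_forall fun s => le_of_eq ?_)
    have hq := base_pos hA B s
    rw [norm_mul, norm_pow, norm_phaseLetter_sq, hβ, Complex.norm_real, Real.norm_of_nonneg (Real.rpow_nonneg hq.le _), mul_comm, ← Real.rpow_add_one hq.ne']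
    norm_num
  -- its real part is `∫ (A² − B²s²)·q^{−5/2}`
  have hre : (∫ s : ℝ, ((((-(1 + r ^ 2 / 2)) : ℝ) : ℂ) + ((β * s : ℝ) : ℂ) * Complex.I) ^ 2 * (((((1 + r ^ 2 / 2) ^ 2 + B ^ 2 * s ^ 2) ^ (-(5 / 2 : ℝ))) : ℝ) : ℂ)).re =
      ∫ s : ℝ, ((1 + r ^ 2 / 2) ^ 2 - B ^ 2 * s ^ 2) * ((1 + r ^ 2 / 2) ^ 2 + B ^ 2 * s ^ 2) ^ (-(5 / 2 : ℝ)) := by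
    have h := integral_re hFint
    simp only [RCLike.re_to_complex] at h
    rw [← h]
    refine integral_congr_ae (Eventually.of_forall fun s => ?_)
    rw [← hβ]
    simp only [pow_two, Complex.mul_re, Complex.add_re, Complex.ofReal_re, Complex.mul_im, Complex.add_im, Complex.ofReal_im, Complex.I_re, Complex.I_im]
    ring
  rw [integral_const_mul, ← mul_assoc, Complex.conj_mul', ← Complex.ofReal_pow, Complex.re_ofReal_mul, hre, integral_re_phaseTwo_eq hA hB]
  exact mul_pos (pow_pos (norm_pos_iff.2 hε) 2) (mul_pos (by positivity) (integral_sq_mul_base_rpow_neg_fiveHalves_pos hA hB))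

end OnePlace

/-! ## §3 HEAD: the archimedean factor at `z = 3∕2` for the phase weights of record -/

section Head

variable (L : Type) [Field L] [NumberField L] [IsCMField L] {δ : L} (hδ : δ ≠ 0)
  [MeasurableSpace (InfiniteAdeleRing L)] [BorelSpace (InfiniteAdeleRing L)]
  [MeasurableSpace (InfiniteAdeleRing ↥(maximalRealSubfield L))] [BorelSpace (InfiniteAdeleRing ↥(maximalRealSubfield L))]
  (μE₁ : Measure (InfiniteAdeleRing L)) [μE₁.IsAddHaarMeasure] (μF₁ : Measure (InfiniteAdeleRing ↥(maximalRealSubfield L))) [μF₁.IsAddHaarMeasure]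

include hδ in
/-- **HEAD (a-10b).  THE ARCHIMEDEAN FACTOR OF THE χ-INTERTWINING AMPLITUDE AT `z = 3∕2` IS NON-ZERO FOR THE PHASE WEIGHTS OF RECORD.**  For every family of constants
`ε_w ∈ ℂ` with `0 < ‖ε_w‖ ≤ 1` (of record: `(−1)^{a_w}`), real `β_w` with `β_w² = (wδ)²` (of record: the sign of the embedding at `w`), and exponents `n_w ∈ {0, 1, 2}` (of record:
`|c_w|`, the `u`-weight of the `K_∞`-type; `t_w = 0`), in ★ (a-3)'s iterated bytes with `s_w(a) = ((ringEquiv_mixedSpace L⁺) a).1 ⟨w|_{L⁺}, _⟩` and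
`ζ_w = −(1 + ‖Ξ_w‖²∕2) + i·β_w·s_w(a)`:
`∫_{L_∞} ∫_{L⁺_∞} (∏_w ε_w·(ζ_w∕|ζ_w|)^{n_w})·ARCH₃(Ξ,a)^{−3∕2} dμ_{F,∞} dμ_{E,∞} ≠ 0` — ★ (a-10) `integral_integral_prodWeight_mul_arch_cpow_neg_ne_zero` at `σ = 3∕2` with the per-place
rotated positivities of §2.  This is the archimedean half of ★ F5's `hA32` for the weights of the J-S8-∞′ table (the finite half is ★ (a-4), the assembly of `A(3∕2) ≠ 0` from the two
halves is the (V)(iii) consumer's). [cite: MoeglinWaldspurger1995, II.1.7, IV.1.11] [cite: Langlands1976, Appendix] -/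
theorem integral_integral_phaseWeights_mul_arch_cpow_neg_threeHalves_ne_zero (ε : InfinitePlace L → ℂ) (hε1 : ∀ w, ‖ε w‖ ≤ 1) (hε0 : ∀ w, ε w ≠ 0)
    (β : InfinitePlace L → ℝ) (hβ : ∀ w, β w ^ 2 = (w δ) ^ 2) (n : InfinitePlace L → ℕ) (hn : ∀ w, n w ≤ 2) :
    (∫ Xi : InfiniteAdeleRing L, ∫ a : InfiniteAdeleRing ↥(maximalRealSubfield L),
      (∏ w : InfinitePlace L, ε w * (((((-(1 + ‖Xi w‖ ^ 2 / 2)) : ℝ) : ℂ) +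
            ((β w * ((InfiniteAdeleRing.ringEquiv_mixedSpace ↥(maximalRealSubfield L)) a).1 ⟨w.comap (algebraMap ↥(maximalRealSubfield L) L), K2E1HeightBigCellLineFormulaU2.isReal_comap_maximalRealSubfield L w⟩ : ℝ) : ℂ) * Complex.I) /
          ((‖(((-(1 + ‖Xi w‖ ^ 2 / 2)) : ℝ) : ℂ) +
            ((β w * ((InfiniteAdeleRing.ringEquiv_mixedSpace ↥(maximalRealSubfield L)) a).1 ⟨w.comap (algebraMap ↥(maximalRealSubfield L) L), K2E1HeightBigCellLineFormulaU2.isReal_comap_maximalRealSubfield L w⟩ : ℝ) : ℂ) * Complex.I‖ : ℝ) : ℂ)) ^ n w) *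
        ((((∏ w : InfinitePlace L, ((1 + ‖(Xi) w‖ ^ 2 / 2) ^ 2 + (w δ) ^ 2 * (((InfiniteAdeleRing.ringEquiv_mixedSpace ↥(maximalRealSubfield L)) a).1 ⟨w.comap (algebraMap ↥(maximalRealSubfield L) L), K2E1HeightBigCellLineFormulaU2.isReal_comap_maximalRealSubfield L w⟩) ^ 2))) : ℝ) : ℂ) ^ (-(3 / 2 : ℂ)) ∂μF₁ ∂μE₁) ≠ 0 := by
  have h := integral_integral_prodWeight_mul_arch_cpow_neg_ne_zero L hδ μE₁ μF₁
    (fun w r s => ε w * (((((-(1 + r ^ 2 / 2)) : ℝ) : ℂ) + ((β w * s : ℝ) : ℂ) * Complex.I) / ((‖(((-(1 + r ^ 2 / 2)) : ℝ) : ℂ) + ((β w * s : ℝ) : ℂ) * Complex.I‖ : ℝ) : ℂ)) ^ n w)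
    (fun w => continuous_phaseWeight (ε w) (β w) (n w)) (fun w r s => norm_phaseWeight_le (hε1 w) (n w) r (β w) s) (σ := 3 / 2) (by norm_num) fun w => ?_
  · rw [show (((3 / 2 : ℝ)) : ℂ) = (3 / 2 : ℂ) by push_cast; ring] at h
    exact h
  · -- the per-place rotated positivity, by cases on `n_w ∈ {0, 1, 2}`
    have hB : w δ ≠ 0 := (InfinitePlace.pos_iff.2 hδ).ne'
    obtain h0 | h1 | h2 : n w = 0 ∨ n w = 1 ∨ n w = 2 := by have := hn w; omega
    · rw [h0]
      exact ⟨conj (ε w), fun r => re_rotated_integral_phaseZero_pos hB (hε0 w) (β w) r⟩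
    · rw [h1]
      exact ⟨-conj (ε w), fun r => re_rotated_integral_phaseOne_pos hB (hβ w) (hε0 w) r⟩
    · rw [h2]
      exact ⟨conj (ε w), fun r => re_rotated_integral_phaseTwo_pos hB (hβ w) (hε0 w) r⟩

end Head

end Summit.HodgeConjecture.HodgeConjecture.Cruxes.H413.K2E1ChiArchNonvanishingPhaseWeightsU3

end
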